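import Summits.QuantumFields.YangMills.Theorems.BalabanLadderIROddTorusLargeFieldRarity
import Summits.QuantumFields.YangMills.Theorems.WeakCouplingRatesLargeFieldTailAllSides
import HarnessLib

/-!
# Hereditary large-field rarity for `SU(2)₄` on the ODD tori, with a VOLUME-FREE base

Support file (seat ym-infvol-p3, fleet R136 (i); bears on crux `IR` = stmt-QuantumFields-19354, registered line
«af-pincer-T» clause (iii_T) of `TypShellCond` / line «hamming» clause (ii); count-neutral helper).

`su2_measureReal_forall_le_cellAction_le_pow`: there are constants `K₀ : ℝ` and `D : ℕ` such that for every ODD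
`L ≥ 3`, every `β ≥ 1`, every `0 ≤ λ ≤ β`, every finite family `(P_i)_{i ∈ F}` of pairwise disjoint sets of plaquettes
of `(ℤ/L)⁴` with at most `n` plaquettes each, and every threshold `T`,

  `μ^{SU(2)}_{L,β} {U | ∀ i ∈ F, T ≤ ∑_{q ∈ P_i} (2 - Re tr U_q)} ≤ (m · exp(-λT/m² + n (K₀ + D log β)/m)) ^ #F`,

`m = #orientations` of `(ℤ/L)⁴` (`= 6`).  The base does NOT depend on `L`: the odd-torus hereditary rarity
`measureReal_forall_le_cellAction_le_pow` (`…OddTorusLargeFieldRarity`) has base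
`m · exp(-λT/m² + n Δ_L(λ)/(m L⁴))`, and the tree's crude partition-function bounds for `SU(2)`
(`WeakCouplingRates.su2_torusLogPartition_nonpos`, `su2_torusLogPartition_lower`) give
`Δ_L(λ) = log Z_L(β-λ) - log Z_L(β) ≤ L⁴ (48 - 4 log C₁ + 2D log β)`.  With `λ = β/2` and fixed `n, T > 0` the base is
`≤ m · exp(-βT/(2m²) + n(K₀ + D log β)/m) → 0` as `β → ∞` — the torus-anchor rarity budget `δ(β)` of clause (iii_T)
for the typicality event «cell action `< T`».

HONEST FRAMING: a finite-torus Peierls–chessboard rarity bound for the bare Wilson action of `SU(2)`; nothing about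
decoupling, typical-data mixing, the mass gap, or infinite volume.
-/

noncomputable section

open MeasureTheory Finset
open Literature.MathematicalPhysics
open Literature.MathematicalPhysics.QuantumFieldTheory Literature.MathematicalPhysics.QuantumLattice
open Summit.QuantumFields.YangMills.Theorems.WeakCouplingRates

namespace Summit.QuantumFields.YangMills.Theorems.OddTorusChessboard

/-- There is at least one plaquette orientation in four dimensions. -/
theorem card_orient_four_pos : 0 < Fintype.card (Orient 4) :=
  Fintype.card_pos_iff.2 ⟨⟨((0 : Fin 4), (1 : Fin 4)), by decide⟩⟩

/-- **Hereditary large-field rarity for `SU(2)₄` on odd tori, volume-free base.**  See the module docstring. -/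
theorem su2_measureReal_forall_le_cellAction_le_pow :
    ∃ K₀ : ℝ, ∃ D : ℕ, ∀ {L : ℕ} [NeZero L], Odd L → 3 ≤ L → ∀ (β : ℝ), 1 ≤ β → ∀ (lam : ℝ), 0 ≤ lam → lam ≤ β →
      ∀ {ι : Type} (F : Finset ι) (P : ι → Finset (Plaquette 4 L)),
        (∀ i ∈ F, ∀ j ∈ F, i ≠ j → Disjoint (P i) (P j)) → ∀ (n : ℕ), (∀ i ∈ F, #(P i) ≤ n) → ∀ T : ℝ,
          (wilsonMeasure (d := 4) (L := L) (fundamentalRep (Fin 2)) β).real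
              {U : GaugeConfig 4 L (Matrix.specialUnitaryGroup (Fin 2) ℂ) |
                ∀ i ∈ F, T ≤ ∑ q ∈ P i, plaquetteCost (fundamentalRep (Fin 2)) U q} ≤
            ((Fintype.card (Orient 4) : ℝ) *
              Real.exp (-(lam * T) / (Fintype.card (Orient 4) : ℝ) ^ 2 +
                n * (K₀ + D * Real.log β) / Fintype.card (Orient 4))) ^ #F := by
  obtain ⟨C₁, hC₁, D, hlow⟩ := su2_torusLogPartition_lower
  refine ⟨48 - 4 * Real.log C₁, 2 * D, ?_⟩
  intro L _ hL hL3 β hβ lam hlam hlamβ ι F P hdisj n hn T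
  set ρ := fundamentalRep (Fin 2) with hρdef
  have hρc : Continuous ρ := continuous_fundamentalRep (Fin 2)
  set m : ℕ := Fintype.card (Orient 4) with hmdef
  have hm := card_orient_four_pos
  have hm0 : (0 : ℝ) < m := by exact_mod_cast hm
  have h := measureReal_forall_le_cellAction_le_pow (d := 4) (L := L) ρ hL hL3 hρc hlam hlamβ F P hdisj hn T hm
  refine h.trans (pow_le_pow_left₀ (by positivity) ?_ _)
  refine mul_le_mul_of_nonneg_left (Real.exp_le_exp.2 ?_) hm0.le
  -- the free-energy-density difference is volume-free
  have hL0 : (0 : ℝ) < (L : ℝ) ^ 4 := by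
    have : (0 : ℝ) < L := by exact_mod_cast (show 0 < L by omega)
    positivity
  have hΔ : torusLogPartition 4 ρ (β - lam) L - torusLogPartition 4 ρ β L ≤
      (L : ℝ) ^ 4 * (48 - 4 * Real.log C₁ + (2 * D : ℕ) * Real.log β) := by
    have h1 : torusLogPartition 4 ρ (β - lam) L ≤ 0 := su2_torusLogPartition_nonpos (by linarith)
    have h2 := hlow L β hβ
    push_cast
    nlinarith
  have hdiv : (torusLogPartition 4 ρ (β - lam) L - torusLogPartition 4 ρ β L) / (L : ℝ) ^ 4 ≤
      48 - 4 * Real.log C₁ + (2 * D : ℕ) * Real.log β := by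
    rw [div_le_iff₀ hL0]
    linarith
  have hn0 : (0 : ℝ) ≤ n := Nat.cast_nonneg _
  have := mul_le_mul_of_nonneg_left hdiv hn0
  refine add_le_add le_rfl ?_
  exact div_le_div_of_nonneg_right this hm0.le

end Summit.QuantumFields.YangMills.Theorems.OddTorusChessboard

end
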